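import Summits.ABC.ABC.Theorems.FewPrimeValuationProductLflInput
import Summits.ABC.ABC.Theorems.RibetTakahashiSplitFewPrimeValuationProductDecomposition
import Summits.ABC.ABC.Theorems.RibetTakahashiSplitFewPrimeValuationProductStubTwoLogOnePrimeLargeHeight
import Summits.ABC.ABC.Theorems.RibetTakahashiSplitFewPrimeValuationProductHardCoreOfXYZ
import Summits.ABC.ABC.Theorems.RibetTakahashiSplitFewPrimeValuationProductHardCoreSmallMember
import Summits.ABC.ABC.Theorems.LogCardinalitySubPowerStewartYu
import Summits.ABC.ABC.Theorems.SoloInformedDoorB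
import HarnessLib

/-!
# The A1.L input `∃ K ≥ 1, PastenApproximationBound K` discharged BY NAME in its remaining `K`-parametric consumers
# (routes `RibetTakahashiSplit` / `LogCardinality` / the solo-informed `p`-adic door)

`Summits/ABC/ABC/Theorems/ApproximationBoundRatConsumerSweep.lean` — unit `abc-inputs-pr-1` (KEY A1L-SWEEP, INPUTS-LIST
row I-16, second file: the consumer sweep; D-0154 (2) INPUTS→UNCONDITIONAL), companion of
`SingleTowerSzpiroUnconditionalCorollaries.lean` (the three X1 files of crux `SingleTowerSzpiro`, stmt-ABC-22410).
PROOFS ONLY (0 definitions, 0 named facts; no landed file is edited). Every theorem is ONE application of a landed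
`K`-parametric theorem to the rung `Summit.ABC.ABC.Theorems.approximationBound_rat_holds : Dioph.approximationBound_rat`
(`= ∃ K : ℝ, 1 ≤ K ∧ PastenApproximationBound K`, route `YuMatveevShapeRat` CLOSED·proved — Matveev 2000 + Yu 2007 over `ℚ`,
PROVED in the tree; ✓ `YuMatveevShapeRatCloses.lean`), in the spelling `Summit.ABC.ABC.Theorems.stub_lflInput`
(✓ `FewPrimeValuationProductLflInput.lean`) where the consumer's hypothesis is the unfolded form.

Consumers swept (INPUTS-LIST row I-16, "same K-parametric hypothesis in …"):

* route `RibetTakahashiSplit`, crux `FewPrimeValuationProduct` (stmt-ABC-1563), line `matveev-face-clearing` — every landed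
  theorem whose FIRST hypothesis is the LFL input `(∃ K : ℝ, 1 ≤ K ∧ Dioph.PastenApproximationBound K)`:
  `stub_faceBound`, `stub_smallPrimeClearing`, `stub_twoLogOnePrime_weak`, `stub_twoLogOnePrime_largeHeight`,
  `hardCore_smallMember_of_lfl` become UNCONDITIONAL (`…_holds`); `stub_decisivePrimeBootstrap`, `hardCore_of_lfl_of_hardCoreXYZ`,
  `freyFewPrime_of_lfl_of_hardCore`, `fewPrimeValuationProduct_of_lfl_of_hardCore_of_residual`,
  `fewPrimeValuationProduct_of_lfl_of_fewPrimeHardCore_of_residual`, `freyValuationProduct_of_lfl_of_twoLog`,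
  `fewPrimeValuationProduct_of_parts` lose the LFL hypothesis and stay CONDITIONAL on their other (open) hypotheses;
  and the decomposition `fewPrimeValuationProduct_iff_fewPrimeHardCore_and_residual` becomes the unconditional
  **`FewPrimeValuationProduct ↔ FewPrimeHardCore ∧ NonFreyResidual`**;
* route `LogCardinality`, crux `SubPowerStewartYu` (stmt-ABC-11053, CLOSED·proved by `subPowerStewartYu_proof`): its first inlined
  hypothesis is `PastenApproximationBound K` verbatim (`Iff.rfl`), so the sub-power Stewart–Yu bound now rests on the Yu 2013
  clause ALONE (`subPowerStewartYu_of_yu2013`) — that clause (Stewart 2013 Lemma 5 over `ℚ` with constants `Aⁿ`) is NOT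
  proved in the tree, so the corollary is CONDITIONAL on it and says so;
* the solo-informed `p`-adic door (`SoloInformedDoorB.lean`): the `σ = 1` member of the door family
  (`soloInformed_padicSigma_one_of_pasten`) holds unconditionally (`soloInformed_padicSigma_one_holds`).

Not swept (reported to the desk instead): the route files `Theses/LogCardinality.lean` (`PowerSavingUpgrade`, stmt-ABC-11055,
OPEN), `Theses/NegOmegaAtlas.lean` (`UnbalancedQuasiPolynomial` stmt-ABC-10558, `PrimeFloorBoundedOmega` stmt-ABC-10559, OPEN;
their inlined hypotheses are abc-triple SPECIALISATIONS of the approximation bound, not the bound itself) and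
`Theses/GiantExponentRegime.lean` (all items closed·moot) — an open item has no proof to specialise, and route files are
gate-written; the internal `K`-parametric analysis lemmas of `LogCardinalitySubPowerStewartYu*.lean` /
`RibetTakahashiSplitFewPrimeValuationProduct*.lean` (plumbing toward the theorems above).

HONESTY (D-0154 (2)). PROVED-MOD-FACT (`PastenApproximationBound K`) → PROVED AS TYPED for the theorems listed, nothing more:
statements are the tree's typed shapes (existential constants); the open hypotheses named above stay open; the cruxes
`FewPrimeValuationProduct` / `FewPrimeHardCore`, A1′ and A-PS are NOT abc and are not proved here; abc moved by 0;
typed ≠ proved. No summit credit.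
-/

noncomputable section

-- `Summit.<Summit>.<Problem>` is the mandated summit-side namespace (CONVENTIONS §2); for the
-- single-conjunct summit `ABC` the two coincide, so the duplicate `ABC.ABC` is deliberate.
set_option linter.dupNamespace false

/-! ### Route `RibetTakahashiSplit`, crux `FewPrimeValuationProduct` (stmt-ABC-1563): the LFL input discharged -/

namespace Summit.ABC.ABC.Theorems.FewPrimeValuationProduct

/-- **The decomposition of the item, unconditionally**: `FewPrimeValuationProduct ↔ FewPrimeHardCore ∧ NonFreyResidual` —
the item (stmt-ABC-1563) is the route crux r4H (stmt-ABC-15197) together with the residual bound on the curves of the class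
without a numerical Frey shadow (`fewPrimeValuationProduct_iff_fewPrimeHardCore_and_residual` at `stub_lflInput`; formerly
"modulo the LFL input" / "from the named fact `evertseGyory_thm_4_2_1_rat`"). Neither side is asserted. [folklore] -/
theorem fewPrimeValuationProduct_iff_fewPrimeHardCore_and_residual_holds :
    Summit.ABC.ABC.Theses.RibetTakahashiSplit.FewPrimeValuationProduct ↔
      (Summit.ABC.ABC.Theses.RibetTakahashiSplit.FewPrimeHardCore ∧
        (∀ ε : ℝ, 0 < ε → ∃ C : ℝ, ∀ (W : WeierstrassCurve ℚ) [W.IsElliptic], (∀ p : ℕ, p.Prime → p ≠ 2 → ¬ p ^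
          2 ∣ W.conductorNorm ℤ) → ((W.conductorNorm ℤ).primeFactors.filter (fun p => p ≠ 2 ∧ ¬ p ^ 2 ∣
          W.conductorNorm ℤ)).card ≤ 3 → (¬ ∃ a b c : ℕ, Literature.NumberTheory.DiophantineGeometry.IsABCTriple a
          b c ∧ (∀ p : ℕ, p.Prime → p ≠ 2 → p ∣ a * b * c → p ∣ W.conductorNorm ℤ) ∧ (∀ p ∈ (W.conductorNorm
          ℤ).primeFactors, ¬ p ^ 2 ∣ W.conductorNorm ℤ → (W.minimalDiscriminantNorm ℤ).factorization p ≤ 2 * (a *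
          b * c).factorization p)) → ((∏ p ∈ (W.conductorNorm ℤ).primeFactors with ¬ p ^ 2 ∣ W.conductorNorm ℤ,
          (W.minimalDiscriminantNorm ℤ).factorization p : ℕ) : ℝ) ≤ C * (W.conductorNorm ℤ : ℝ) ^ ε)) :=
  fewPrimeValuationProduct_iff_fewPrimeHardCore_and_residual Summit.ABC.ABC.Theorems.stub_lflInput

/-- **Face clearing (registered stub `stub_faceBound` of line `matveev-face-clearing`, crux `FewPrimeValuationProduct`
stmt-ABC-1563), unconditionally**: there are `A : ℕ`, `κ` with `log c ≤ κ · (log rad(abc))^A` for every abc triple on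
`≤ 4` primes one of whose members is a power of two (`stub_faceBound` at the LFL input `stub_lflInput`, itself the rung
`approximationBound_rat_holds`). [folklore] -/
theorem stub_faceBound_holds :
    ∃ (A : ℕ) (κ : ℝ), ∀ a b c : ℕ, Literature.NumberTheory.DiophantineGeometry.IsABCTriple a b c →
      (a * b * c).primeFactors.card ≤ 4 →
      ((∃ j : ℕ, a = 2 ^ j) ∨ (∃ j : ℕ, b = 2 ^ j) ∨ (∃ j : ℕ, c = 2 ^ j)) →
      Real.log c ≤ κ * Real.log (Literature.NumberTheory.DiophantineGeometry.rad a b c : ℝ) ^ A :=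
  stub_faceBound Summit.ABC.ABC.Theorems.stub_lflInput

/-- **Small-prime clearing in the hard core (registered stub `stub_smallPrimeClearing`, stmt-ABC-1563), unconditionally**:
for every `ε > 0` there is `C` with `∏_{p ∣ abc} v_p(abc) ≤ C · rad(abc)^{5ε}` for every abc triple on `≤ 4` primes, no member a
power of two, having an odd prime `p ∣ abc` with `p ≤ rad(abc)^ε` (`stub_smallPrimeClearing` at `stub_lflInput`). [folklore] -/
theorem stub_smallPrimeClearing_holds :
    ∀ ε : ℝ, 0 < ε → ∃ C : ℝ, ∀ a b c : ℕ, Literature.NumberTheory.DiophantineGeometry.IsABCTriple a b c →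
      (a * b * c).primeFactors.card ≤ 4 →
      ¬ ((∃ j : ℕ, a = 2 ^ j) ∨ (∃ j : ℕ, b = 2 ^ j) ∨ (∃ j : ℕ, c = 2 ^ j)) →
      (∃ p ∈ (a * b * c).primeFactors, p ≠ 2 ∧
        (p : ℝ) ≤ (Literature.NumberTheory.DiophantineGeometry.rad a b c : ℝ) ^ ε) →
      ((∏ p ∈ (a * b * c).primeFactors, (a * b * c).factorization p : ℕ) : ℝ) ≤
        C * (Literature.NumberTheory.DiophantineGeometry.rad a b c : ℝ) ^ (5 * ε) :=
  stub_smallPrimeClearing Summit.ABC.ABC.Theorems.stub_lflInput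

/-- **`TwoLogOnePrime`, weak (Yu-defect) form (registered sub-goal `stub_twoLogOnePrime_weak`, stmt-ABC-1563), unconditionally**:
there is `C` with `ord_ℓ(p^x + σ 2^k q^y) ≤ C · ℓ · log p · log q · (1 + log(x+y+k+2) + log(log p + log q))` for all distinct odd
primes `ℓ, p, q`, `x, y ≥ 1`, `k`, `σ = ±1` (`stub_twoLogOnePrime_weak` at `stub_lflInput`). [cite: Pasten2024, Theorem 2.1] -/
theorem stub_twoLogOnePrime_weak_holds :
    ∃ C : ℝ, ∀ ℓ p q : ℕ, ℓ.Prime → p.Prime → q.Prime → ℓ ≠ 2 → p ≠ 2 → q ≠ 2 → ℓ ≠ p → ℓ ≠ q → p ≠ q →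
      ∀ x y k : ℕ, 1 ≤ x → 1 ≤ y → ∀ σ : ℤ, (σ = 1 ∨ σ = -1) →
      (padicValInt ℓ ((p : ℤ) ^ x + σ * 2 ^ k * (q : ℤ) ^ y) : ℝ) ≤ C * (ℓ : ℝ) * (Real.log p * Real.log q) * (1 + Real.log ((x + y + k + 2 : ℕ) : ℝ) + Real.log (Real.log p + Real.log q)) :=
  stub_twoLogOnePrime_weak Summit.ABC.ABC.Theorems.stub_lflInput

/-- **`TwoLogOnePrime` in the large-height regime (registered sub-goal `stub_twoLogOnePrime_largeHeight`, stmt-ABC-1563),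
unconditionally**: for every real `η` and `ε > 0` there is `C` with
`ord_ℓ(p^x + σ 2^k q^y) ≤ C · ℓ^ε · (log p · log q · (k+1))² · max(x,y)^{1−η}` whenever `ℓ · (1 + log(2 max(x,y) + 2)) ≤ max(x,y)^{1−η}`
(`stub_twoLogOnePrime_largeHeight` at `stub_lflInput`). [cite: Pasten2024, Theorem 2.1] -/
theorem stub_twoLogOnePrime_largeHeight_holds :
    ∀ η ε : ℝ, 0 < ε → ∃ C : ℝ, ∀ ℓ p q : ℕ, ℓ.Prime → p.Prime → q.Prime → ℓ ≠ 2 → p ≠ 2 → q ≠ 2 → ℓ ≠ p → ℓ ≠ q →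
      p ≠ q → ∀ x y k : ℕ, 1 ≤ x → 1 ≤ y → ∀ σ : ℤ, (σ = 1 ∨ σ = -1) →
      (ℓ : ℝ) * (1 + Real.log (2 * ((max x y : ℕ) : ℝ) + 2)) ≤ ((max x y : ℕ) : ℝ) ^ (1 - η) →
      (padicValInt ℓ ((p : ℤ) ^ x + σ * 2 ^ k * (q : ℤ) ^ y) : ℝ) ≤ C * (ℓ : ℝ) ^ ε * (Real.log p * Real.log q * (k + 1)) ^ 2 * ((max x y : ℕ) : ℝ) ^ (1 - η) :=
  stub_twoLogOnePrime_largeHeight Summit.ABC.ABC.Theorems.stub_lflInput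

/-- **Decisive-prime bootstrap (registered stub `stub_decisivePrimeBootstrap`, stmt-ABC-1563) with the LFL input discharged**:
the two-logarithm one-prime depth bound `TwoLogOnePrime(η)` ALONE now implies, for every `ε > 0`, `∏_{p ∣ abc} v_p(abc) ≤ C · rad(abc)^ε`
on the balanced hard core (abc triples on `≤ 4` primes, no member a power of two, every odd prime `> rad^ε`)
(`stub_decisivePrimeBootstrap` at `stub_lflInput`). Still CONDITIONAL on its `TwoLogOnePrime` hypothesis (open). [folklore] -/
theorem stub_decisivePrimeBootstrap_holds :
    (∃ η : ℝ, 0 < η ∧ ∀ ε : ℝ, 0 < ε → ∃ (A : ℕ) (C : ℝ), ∀ ℓ p q : ℕ, ℓ.Prime → p.Prime → q.Prime →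
      ℓ ≠ 2 → p ≠ 2 → q ≠ 2 → ℓ ≠ p → ℓ ≠ q → p ≠ q →
      ∀ x y k : ℕ, 1 ≤ x → 1 ≤ y → ∀ σ : ℤ, (σ = 1 ∨ σ = -1) →
        (ℓ : ℝ) ^ ε ≤ (padicValInt ℓ ((p : ℤ) ^ x + σ * 2 ^ k * (q : ℤ) ^ y) : ℝ) →
        (padicValInt ℓ ((p : ℤ) ^ x + σ * 2 ^ k * (q : ℤ) ^ y) : ℝ) ≤
          C * (ℓ : ℝ) ^ ε * (Real.log p * Real.log q * (k + 1)) ^ A * ((max x y : ℕ) : ℝ) ^ (1 - η)) →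
    ∀ ε : ℝ, 0 < ε → ∃ C : ℝ, ∀ a b c : ℕ, Literature.NumberTheory.DiophantineGeometry.IsABCTriple a b c →
      (a * b * c).primeFactors.card ≤ 4 →
      ¬ ((∃ j : ℕ, a = 2 ^ j) ∨ (∃ j : ℕ, b = 2 ^ j) ∨ (∃ j : ℕ, c = 2 ^ j)) →
      (∀ p ∈ (a * b * c).primeFactors, p ≠ 2 →
        (Literature.NumberTheory.DiophantineGeometry.rad a b c : ℝ) ^ ε < p) →
      ((∏ p ∈ (a * b * c).primeFactors, (a * b * c).factorization p : ℕ) : ℝ) ≤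
        C * (Literature.NumberTheory.DiophantineGeometry.rad a b c : ℝ) ^ ε :=
  stub_decisivePrimeBootstrap Summit.ABC.ABC.Theorems.stub_lflInput

/-- **The hard core from its `xyz`-part, with the LFL input discharged**: a bound `xyz ≤ C_ε (2pqr)^ε` on the solutions of
`p^x ± q^y = ± 2^k r^z` ALONE now gives the hard core `xyzk ≤ C_ε (2pqr)^ε` (`hardCore_of_lfl_of_hardCoreXYZ` at `stub_lflInput`;
the `2`-adic factor `k` is paid by the approximation bound). CONDITIONAL on the `xyz` hypothesis (open, abc/Pillai strength). [folklore] -/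
theorem hardCore_of_hardCoreXYZ :
    (∀ ε : ℝ, 0 < ε → ∃ C : ℝ, ∀ p q r x y z k : ℕ, p.Prime → q.Prime → r.Prime →
      Odd p → Odd q → Odd r → p ≠ q → p ≠ r → q ≠ r → 0 < x → 0 < y → 0 < z → 0 < k →
      (p ^ x + q ^ y = 2 ^ k * r ^ z ∨ p ^ x + 2 ^ k * r ^ z = q ^ y ∨
        q ^ y + 2 ^ k * r ^ z = p ^ x) →
      ((x * y * z : ℕ) : ℝ) ≤ C * ((2 * p * q * r : ℕ) : ℝ) ^ ε) →
    ∀ ε : ℝ, 0 < ε → ∃ C : ℝ, ∀ p q r x y z k : ℕ, p.Prime → q.Prime → r.Prime →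
      Odd p → Odd q → Odd r → p ≠ q → p ≠ r → q ≠ r → 0 < x → 0 < y → 0 < z → 0 < k →
      (p ^ x + q ^ y = 2 ^ k * r ^ z ∨ p ^ x + 2 ^ k * r ^ z = q ^ y ∨
        q ^ y + 2 ^ k * r ^ z = p ^ x) →
      ((x * y * z * k : ℕ) : ℝ) ≤ C * ((2 * p * q * r : ℕ) : ℝ) ^ ε :=
  hardCore_of_lfl_of_hardCoreXYZ Summit.ABC.ABC.Theorems.stub_lflInput

/-- **The hard core on the small-member locus, unconditionally**: for every `A` and `ε > 0` there is `C` with `xyzk ≤ C · (2pqr)^ε` for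
every solution of `p^x + q^y = 2^k r^z` (and its two rearrangements) in distinct odd primes whose smallest member is `≤ (2pqr)^A`
(`hardCore_smallMember_of_lfl` at `stub_lflInput`). [folklore] -/
theorem hardCore_smallMember_holds :
    ∀ A : ℝ, ∀ ε : ℝ, 0 < ε → ∃ C : ℝ, ∀ p q r x y z k : ℕ, p.Prime → q.Prime → r.Prime →
      Odd p → Odd q → Odd r → p ≠ q → p ≠ r → q ≠ r → 0 < x → 0 < y → 0 < z → 0 < k →
      (p ^ x + q ^ y = 2 ^ k * r ^ z ∨ p ^ x + 2 ^ k * r ^ z = q ^ y ∨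
        q ^ y + 2 ^ k * r ^ z = p ^ x) →
      (min (min ((p : ℝ) ^ x) ((q : ℝ) ^ y)) ((2 : ℝ) ^ k * (r : ℝ) ^ z) ≤
        ((2 * p * q * r : ℕ) : ℝ) ^ A) →
      ((x * y * z * k : ℕ) : ℝ) ≤ C * ((2 * p * q * r : ℕ) : ℝ) ^ ε :=
  hardCore_smallMember_of_lfl Summit.ABC.ABC.Theorems.stub_lflInput

/-- **Frey part from the hard core, with the LFL input discharged**: the hard-core bound ALONE now gives the valuation-product bound
`∏_{p ∣ abc} v_p(abc) ≤ K_ε rad(abc)^ε` for abc triples on `≤ 4` primes (`freyFewPrime_of_lfl_of_hardCore` at `stub_lflInput`).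
CONDITIONAL on the hard core (open). [folklore] -/
theorem freyFewPrime_of_hardCore :
    (∀ ε : ℝ, 0 < ε → ∃ C : ℝ, ∀ p q r x y z k : ℕ, p.Prime → q.Prime → r.Prime → Odd p → Odd q → Odd r → p ≠ q →
      p ≠ r → q ≠ r → 0 < x → 0 < y → 0 < z → 0 < k →
      (p ^ x + q ^ y = 2 ^ k * r ^ z ∨ p ^ x + 2 ^ k * r ^ z = q ^ y ∨ q ^ y + 2 ^ k * r ^ z = p ^ x) →
      ((x * y * z * k : ℕ) : ℝ) ≤ C * ((2 * p * q * r : ℕ) : ℝ) ^ ε) → ∀ ε : ℝ, 0 < ε →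
      ∃ K : ℝ, ∀ a b c : ℕ, Literature.NumberTheory.DiophantineGeometry.IsABCTriple a b c →
      (a * b * c).primeFactors.card ≤ 4 →
      ((∏ p ∈ (a * b * c).primeFactors, (a * b * c).factorization p : ℕ) : ℝ) ≤ K * (Literature.NumberTheory.DiophantineGeometry.rad a b c : ℝ) ^ ε :=
  freyFewPrime_of_lfl_of_hardCore Summit.ABC.ABC.Theorems.stub_lflInput

/-- **The item from hard core ∧ non-Frey residual, with the LFL input discharged** (`fewPrimeValuationProduct_of_lfl_of_hardCore_of_residual`
at `stub_lflInput`). CONDITIONAL on its two remaining hypotheses (open). [folklore] -/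
theorem fewPrimeValuationProduct_of_hardCore_of_residual :
    (∀ ε : ℝ, 0 < ε → ∃ C : ℝ, ∀ p q r x y z k : ℕ, p.Prime → q.Prime → r.Prime → Odd p → Odd q → Odd r → p ≠ q →
      p ≠ r → q ≠ r → 0 < x → 0 < y → 0 < z → 0 < k →
      (p ^ x + q ^ y = 2 ^ k * r ^ z ∨ p ^ x + 2 ^ k * r ^ z = q ^ y ∨ q ^ y + 2 ^ k * r ^ z = p ^ x) →
      ((x * y * z * k : ℕ) : ℝ) ≤ C * ((2 * p * q * r : ℕ) : ℝ) ^ ε) → (∀ ε : ℝ, 0 < ε →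
      ∃ C : ℝ, ∀ (W : WeierstrassCurve ℚ) [W.IsElliptic], (∀ p : ℕ, p.Prime → p ≠ 2 → ¬ p ^ 2 ∣ W.conductorNorm ℤ) →
      ((W.conductorNorm ℤ).primeFactors.filter (fun p => p ≠ 2 ∧ ¬ p ^ 2 ∣ W.conductorNorm ℤ)).card ≤ 3 →
      (¬ ∃ a b c : ℕ, Literature.NumberTheory.DiophantineGeometry.IsABCTriple a b c ∧ (∀ p : ℕ, p.Prime → p ≠ 2 →
      p ∣ a * b * c → p ∣ W.conductorNorm ℤ) ∧ (∀ p ∈ (W.conductorNorm ℤ).primeFactors, ¬ p ^ 2 ∣ W.conductorNorm ℤ →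
      (W.minimalDiscriminantNorm ℤ).factorization p ≤ 2 * (a * b * c).factorization p)) →
      ((∏ p ∈ (W.conductorNorm ℤ).primeFactors with ¬ p ^ 2 ∣ W.conductorNorm ℤ, (W.minimalDiscriminantNorm ℤ).factorization p : ℕ) : ℝ) ≤ C * (W.conductorNorm ℤ : ℝ) ^ ε) →
      Summit.ABC.ABC.Theses.RibetTakahashiSplit.FewPrimeValuationProduct :=
  fewPrimeValuationProduct_of_lfl_of_hardCore_of_residual Summit.ABC.ABC.Theorems.stub_lflInput

/-- **r4 from r4H ∧ residual, by name, with the LFL input discharged**: the route crux `FewPrimeHardCore` (stmt-ABC-15197) and the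
non-Frey residual imply the item `FewPrimeValuationProduct` (stmt-ABC-1563)
(`fewPrimeValuationProduct_of_lfl_of_fewPrimeHardCore_of_residual` at `stub_lflInput`). [folklore] -/
theorem fewPrimeValuationProduct_of_fewPrimeHardCore_of_residual :
    Summit.ABC.ABC.Theses.RibetTakahashiSplit.FewPrimeHardCore →
    (∀ ε : ℝ, 0 < ε → ∃ C : ℝ, ∀ (W : WeierstrassCurve ℚ) [W.IsElliptic], (∀ p : ℕ, p.Prime → p ≠ 2 →
      ¬ p ^ 2 ∣ W.conductorNorm ℤ) →
      ((W.conductorNorm ℤ).primeFactors.filter (fun p => p ≠ 2 ∧ ¬ p ^ 2 ∣ W.conductorNorm ℤ)).card ≤ 3 →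
      (¬ ∃ a b c : ℕ, Literature.NumberTheory.DiophantineGeometry.IsABCTriple a b c ∧ (∀ p : ℕ, p.Prime → p ≠ 2 →
      p ∣ a * b * c → p ∣ W.conductorNorm ℤ) ∧ (∀ p ∈ (W.conductorNorm ℤ).primeFactors, ¬ p ^ 2 ∣ W.conductorNorm ℤ →
      (W.minimalDiscriminantNorm ℤ).factorization p ≤ 2 * (a * b * c).factorization p)) →
      ((∏ p ∈ (W.conductorNorm ℤ).primeFactors with ¬ p ^ 2 ∣ W.conductorNorm ℤ, (W.minimalDiscriminantNorm ℤ).factorization p : ℕ) : ℝ) ≤ C * (W.conductorNorm ℤ : ℝ) ^ ε) →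
    Summit.ABC.ABC.Theses.RibetTakahashiSplit.FewPrimeValuationProduct :=
  fewPrimeValuationProduct_of_lfl_of_fewPrimeHardCore_of_residual Summit.ABC.ABC.Theorems.stub_lflInput

/-- **Frey part from `TwoLogOnePrime`, with the LFL input discharged** (`freyValuationProduct_of_lfl_of_twoLog` at `stub_lflInput`).
CONDITIONAL on the `TwoLogOnePrime(η)` hypothesis (open). [folklore] -/
theorem freyValuationProduct_of_twoLog :
    (∃ η : ℝ, 0 < η ∧ ∀ ε : ℝ, 0 < ε → ∃ (A : ℕ) (C : ℝ), ∀ ℓ p q : ℕ, ℓ.Prime → p.Prime → q.Prime → ℓ ≠ 2 → p ≠ 2 →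
      q ≠ 2 → ℓ ≠ p → ℓ ≠ q → p ≠ q → ∀ x y k : ℕ, 1 ≤ x → 1 ≤ y → ∀ σ : ℤ, (σ = 1 ∨ σ = -1) →
      (ℓ : ℝ) ^ ε ≤ (padicValInt ℓ ((p : ℤ) ^ x + σ * 2 ^ k * (q : ℤ) ^ y) : ℝ) →
      (padicValInt ℓ ((p : ℤ) ^ x + σ * 2 ^ k * (q : ℤ) ^ y) : ℝ) ≤ C * (ℓ : ℝ) ^ ε * (Real.log p * Real.log q * (k + 1)) ^ A * ((max x y : ℕ) : ℝ) ^ (1 - η)) →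
      ∀ ε : ℝ, 0 < ε → ∃ K : ℝ, ∀ a b c : ℕ, Literature.NumberTheory.DiophantineGeometry.IsABCTriple a b c →
      (a * b * c).primeFactors.card ≤ 4 →
      ((∏ p ∈ (a * b * c).primeFactors, (a * b * c).factorization p : ℕ) : ℝ) ≤ K * (Literature.NumberTheory.DiophantineGeometry.rad a b c : ℝ) ^ ε :=
  freyValuationProduct_of_lfl_of_twoLog Summit.ABC.ABC.Theorems.stub_lflInput

/-- **The item from its parts, with the LFL input discharged**: `TwoLogOnePrime(η)` and the non-Frey residual imply
`FewPrimeValuationProduct` (`fewPrimeValuationProduct_of_parts` at `stub_lflInput`). CONDITIONAL on those two hypotheses (open).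
[folklore] -/
theorem fewPrimeValuationProduct_of_parts_holds :
    (∃ η : ℝ, 0 < η ∧ ∀ ε : ℝ, 0 < ε → ∃ (A : ℕ) (C : ℝ), ∀ ℓ p q : ℕ, ℓ.Prime → p.Prime → q.Prime → ℓ ≠ 2 → p ≠ 2 →
      q ≠ 2 → ℓ ≠ p → ℓ ≠ q → p ≠ q → ∀ x y k : ℕ, 1 ≤ x → 1 ≤ y → ∀ σ : ℤ, (σ = 1 ∨ σ = -1) →
      (ℓ : ℝ) ^ ε ≤ (padicValInt ℓ ((p : ℤ) ^ x + σ * 2 ^ k * (q : ℤ) ^ y) : ℝ) →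
      (padicValInt ℓ ((p : ℤ) ^ x + σ * 2 ^ k * (q : ℤ) ^ y) : ℝ) ≤ C * (ℓ : ℝ) ^ ε * (Real.log p * Real.log q * (k + 1)) ^ A * ((max x y : ℕ) : ℝ) ^ (1 - η)) →
      (∀ ε : ℝ, 0 < ε → ∃ C : ℝ, ∀ (W : WeierstrassCurve ℚ) [W.IsElliptic], (∀ p : ℕ, p.Prime → p ≠ 2 →
      ¬ p ^ 2 ∣ W.conductorNorm ℤ) →
      ((W.conductorNorm ℤ).primeFactors.filter (fun p => p ≠ 2 ∧ ¬ p ^ 2 ∣ W.conductorNorm ℤ)).card ≤ 3 →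
      (¬ ∃ a b c : ℕ, Literature.NumberTheory.DiophantineGeometry.IsABCTriple a b c ∧ (∀ p : ℕ, p.Prime → p ≠ 2 →
      p ∣ a * b * c → p ∣ W.conductorNorm ℤ) ∧ (∀ p ∈ (W.conductorNorm ℤ).primeFactors, ¬ p ^ 2 ∣ W.conductorNorm ℤ →
      (W.minimalDiscriminantNorm ℤ).factorization p ≤ 2 * (a * b * c).factorization p)) →
      ((∏ p ∈ (W.conductorNorm ℤ).primeFactors with ¬ p ^ 2 ∣ W.conductorNorm ℤ, (W.minimalDiscriminantNorm ℤ).factorization p : ℕ) : ℝ) ≤ C * (W.conductorNorm ℤ : ℝ) ^ ε) →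
      Summit.ABC.ABC.Theses.RibetTakahashiSplit.FewPrimeValuationProduct :=
  fewPrimeValuationProduct_of_parts Summit.ABC.ABC.Theorems.stub_lflInput

end Summit.ABC.ABC.Theorems.FewPrimeValuationProduct

/-! ### Route `LogCardinality`, crux `SubPowerStewartYu` (stmt-ABC-11053): the Pasten clause discharged -/

namespace Summit.ABC.ABC.Theorems

/-- **Sub-power Stewart–Yu for all abc triples, modulo the Yu 2013 clause ALONE.** For every `A` such that Yu's 2013
`p`-adic bound over `ℚ` holds with constant `Aⁿ` (the crux's second inlined hypothesis, Stewart 2013 Lemma 5 with `d = 1`;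
NOT proved in the tree — this theorem is CONDITIONAL on it), there are `c₀ > 0`, `κ`, `R₀` with
`log c ≤ κ · rad(abc)^{1/3} · exp(−c₀ log rad / log log rad)` for every abc triple with `rad(abc) ≥ R₀` — the closed crux
`SubPowerStewartYu` (`subPowerStewartYu_proof`) with its first hypothesis, `PastenApproximationBound K` inlined verbatim,
supplied by the rung `approximationBound_rat_holds`. [cite: StewartYu2001, Theorem 1]
[cite: Stewart2013, Lemma 8 (arXiv:1008.1274 pp. 9–10)] -/
theorem subPowerStewartYu_of_yu2013 :
    ∀ A : ℝ,
      (∀ (n p : ℕ) (α : Fin n → ℚ) (b : Fin n → ℤ), 1 ≤ n → p.Prime → 5 ≤ p → (∀ i, α i ≠ 0 ∧ padicValRat p (α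
      i) = 0) → (∀ e : Fin n → ℤ, ∏ i, α i ^ e i = 1 → e = 0) → b ≠ 0 → (padicValRat p (∏ i, α i ^ b i - 1) : ℝ)
      ≤ A ^ n * max ((p : ℝ) * ((n : ℝ) / Real.log p) ^ n) (Real.exp n * Real.log p) * (∏ i, max 1
      (Height.logHeight₁ (α i))) * max (Real.log (2 + ∑ i, |(b i : ℝ)|)) ((n : ℝ) ^ 2)) →
      ∃ c₀ : ℝ, 0 < c₀ ∧ ∃ κ R₀ : ℝ, ∀ a b c : ℕ, Literature.NumberTheory.DiophantineGeometry.IsABCTriple a b c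
      → R₀ ≤ (Literature.NumberTheory.DiophantineGeometry.rad a b c : ℝ) → Real.log c ≤ κ *
      (Literature.NumberTheory.DiophantineGeometry.rad a b c : ℝ) ^ (1 / 3 : ℝ) * Real.exp (-(c₀ * Real.log
      (Literature.NumberTheory.DiophantineGeometry.rad a b c : ℝ) / Real.log (Real.log
      (Literature.NumberTheory.DiophantineGeometry.rad a b c : ℝ)))) := by
  intro A hYu
  obtain ⟨K, hK, hP⟩ := approximationBound_rat_holds
  exact subPowerStewartYu_proof K A hK hP hYu

/-! ### The solo-informed `p`-adic door: its `σ = 1` member holds -/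

/-- **The known member of the `p`-adic door family holds unconditionally**: there is `K ≥ 1` such that the `p`-adic clause
with prime-dependence `p^σ`, `σ = 1`, and constant `K / log 2` holds for all `ι, ξ, ζ, b, p` as in Pasten's Theorem 2.1 over `ℚ`
(`soloInformed_padicSigma_one_of_pasten` at the rung `approximationBound_rat_holds`). The door theorem
`soloInformed_log_le_rpow_of_padicSigma` turns `σ` into the exponent `log c ≤ C_ε rad^{σ+ε}`; at `σ = 1` this is weaker than
Stewart–Yu and is recorded only as the proved end of the family. [cite: Pasten2024, Theorem 2.1] -/
theorem soloInformed_padicSigma_one_holds :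
    ∃ K : ℝ, 1 ≤ K ∧ ∀ (ι : Type) [Fintype ι], 0 < Fintype.card ι → ∀ ξ : ι → ℚ,
      (∀ i, ξ i ≠ 0 ∧ ξ i ≠ 1 ∧ ξ i ≠ -1) → ∀ ζ : ℚ, (ζ = 1 ∨ ζ = -1) → ∀ b : ι → ℤ,
      ζ * ∏ i, ξ i ^ b i ≠ 1 → ∀ p : ℕ, p.Prime →
      (padicValRat p (1 - ζ * ∏ i, ξ i ^ b i) : ℝ) * Real.log p <
        (K / Real.log 2) ^ Fintype.card ι * (p : ℝ) ^ (1 : ℝ) *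
          Real.log (max (Real.exp 1) (p * Height.logHeight₁ (ζ * ∏ i, ξ i ^ b i))) *
            ∏ i, Height.logHeight₁ (ξ i) := by
  obtain ⟨K, hK, hP⟩ := approximationBound_rat_holds
  exact ⟨K, hK, soloInformed_padicSigma_one_of_pasten hK hP⟩

end Summit.ABC.ABC.Theorems

end
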